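import Summits.Parity.GeneralizedHardyLittlewood.Theorems.BeyondDiagonalBeatsQuarter.PeterssonSplitDiagLine
import Summits.Parity.GeneralizedHardyLittlewood.Theorems.BeyondDiagonalBeatsQuarter.PeterssonSplitFiber
import Summits.Parity.GeneralizedHardyLittlewood.Theorems.BeyondDiagonalBeatsQuarter.CornerReduction
import Summits.Parity.GeneralizedHardyLittlewood.Theorems.BeyondDiagonalBeatsQuarter.KernelFormXSqBridge
import HarnessLib

/-!
# Route `PrimeLevelFamEdge`, crux K_B (stmt-Parity-20343), line `diagonal_kernel_split`:
# **helper H4 — the exact Petersson/AFE split of the mollified second moment at `P = X²`, `Q = 1`**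

Assembly of parts (a) `PeterssonSplitExpansion`, (b) `PeterssonSplitAFE`, (c) `PeterssonSplitDiagOff`,
(d2) `PeterssonSplitDiagLine`, (d3) `PeterssonSplitFiber`, with (d1) here (`tsum_afeWeight_diagCount`:
the Petersson diagonal of the AFE ⊗ Hecke expansion IS the true diagonal kernel,
`Σ_n w_q(n)·diagCount a b n = (ab)^{1/2}·Corner.trueDiagKernel q̂ a b`). Result (**`QhPQ_X_sq_one_split`**):
for `q` prime and `1 ≤ M < q`,
`Q^h(X², 1; M) = 2q̂·Σ_{l,m ≤ M} x_l x_m·K_true(q̂; l, m) − Σ_{l,m ≤ M} (x_l l^{−1/2})(x_m m^{−1/2})·OFF_q(l,m)`,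
`x_m = μ(m)ψ(m)⁻¹(log(M/m)/log M)²` (`KernelFormXSq.xsq`), `K_true = Corner.trueDiagKernel` (helper H1, p622893),
`OFF_q(l,m) = 2q̂ Σ_{(n₁,n₂)} w_q(n₁,n₂) Σ_{d₁∣(l,n₁)} Σ_{d₂∣(m,n₂)} J_q(l n₁/d₁², m n₂/d₂²)` the explicit,
absolutely convergent Kloosterman–Bessel double series (`J_q = KowalskiMichel2000.petJ`). This is STUB-PLAN §5
H4 / §1.2 («what any proof must expand»): `Q^h − 2q̂K = 2q̂·CORNER + OFF-part` exactly — with H1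
(`Corner.cornerNegligibleXSq`) the registered heart `stub_kernelExcessBelowSlack_io` is now LITERALLY a
statement about `OFF_q` along good primes. No bound is proved here; identities only. Helper; closes nothing.
«The programme SEARCHES and TYPES; no claim about Landau–Siegel zeros, Theorems 1–2 of arXiv:2211.02515 or
a repaired Margin232 until a kernel theorem says so.»
-/

noncomputable section

open Finset Polynomial
open scoped Real ArithmeticFunction.Moebius

namespace Summit.Parity.GeneralizedHardyLittlewood.Theorems.BeyondDiagonalBeatsQuarter.PeterssonSplit

open Literature.NumberTheory.LFunctions Literature.NumberTheory.LFunctions.KMV2000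
open KernelFormXSq (xsq)

variable {q : ℕ}

/-! ### (d1) The diagonal count as a sum of line indicators; the diagonal series is the true kernel -/

/-- For `a ≠ 0`: the divisors of `gcd(a, n)` are the divisors of `a` dividing `n`. [folklore] -/
theorem divisors_gcd_eq_filter {a : ℕ} (ha : a ≠ 0) (n : ℕ) :
    (a.gcd n).divisors = a.divisors.filter (· ∣ n) := by
  ext d
  simp only [Nat.mem_divisors, Finset.mem_filter, Nat.dvd_gcd_iff]
  constructor
  · rintro ⟨⟨h1, h2⟩, -⟩; exact ⟨⟨h1, ha⟩, h2⟩
  · rintro ⟨⟨h1, -⟩, h2⟩; exact ⟨⟨h1, h2⟩, Nat.gcd_ne_zero_left ha⟩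

/-- `diagCount a b n = Σ_{d₁ ∣ a, d₂ ∣ b} 𝟙[d₁ ∣ n₁, d₂ ∣ n₂, a n₁/d₁² = b n₂/d₂²]` (`a, b ≠ 0`).
[cite: KowalskiMichelVanderKam2000, (21)–(23) p. 12 — derivation] -/
theorem diagCount_eq_sum {a b : ℕ} (ha : a ≠ 0) (hb : b ≠ 0) (n : ℕ × ℕ) :
    (diagCount a b n : ℝ) = ∑ p ∈ a.divisors ×ˢ b.divisors,
      (if p.1 ∣ n.1 ∧ p.2 ∣ n.2 ∧ a * n.1 / p.1 ^ 2 = b * n.2 / p.2 ^ 2 then (1 : ℝ) else 0) := by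
  classical
  unfold diagCount
  rw [divisors_gcd_eq_filter ha, divisors_gcd_eq_filter hb, ← Finset.filter_product,
    Finset.filter_filter, Finset.card_filter]
  push_cast
  refine Finset.sum_congr rfl fun p _ ↦ ?_
  by_cases h : p.1 ∣ n.1 ∧ p.2 ∣ n.2 ∧ a * n.1 / p.1 ^ 2 = b * n.2 / p.2 ^ 2
  · rw [if_pos h, if_pos ⟨⟨h.1, h.2.1⟩, h.2.2⟩]
  · rw [if_neg h, if_neg (fun h' ↦ h ⟨h'.1.1, h'.1.2, h'.2⟩)]

/-- **(d1)+(d2)+(d3): the Petersson diagonal of the AFE ⊗ Hecke expansion is the TRUE diagonal kernel.**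
For `q ≥ 1`, `a, b ≠ 0`: `Σ_n w_q(n)·diagCount a b n = (ab)^{1/2}·Corner.trueDiagKernel q̂ a b`.
[cite: KowalskiMichelVanderKam2000, (21)–(23) p. 12–13 and Prop. 5.1 — derivation] -/
theorem hasSum_afeWeight_diagCount (hq : 1 ≤ q) {a b : ℕ} (ha : a ≠ 0) (hb : b ≠ 0) :
    HasSum (fun n : ℕ × ℕ ↦ afeWeight q n * (diagCount a b n : ℝ))
      (((a : ℝ) * b) ^ (1 / 2 : ℝ) * Corner.trueDiagKernel (qhat q) a b) := by
  classical
  have hab : (0 : ℝ) < (a : ℝ) * b := by positivity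
  -- sum of the lines
  have hlines := hasSum_sum (s := a.divisors ×ˢ b.divisors)
    (f := fun (p : ℕ × ℕ) (n : ℕ × ℕ) ↦ if p.1 ∣ n.1 ∧ p.2 ∣ n.2 ∧ a * n.1 / p.1 ^ 2 = b * n.2 / p.2 ^ 2
      then afeWeight q n else 0)
    (fun p hp ↦ by
      simp only [Finset.mem_product, Nat.mem_divisors] at hp
      exact hasSum_afeWeight_line hq ha hb hp.1.1 hp.2.1)
  -- the summand is w·diagCount
  have hfun : (fun n : ℕ × ℕ ↦ ∑ p ∈ a.divisors ×ˢ b.divisors,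
      (if p.1 ∣ n.1 ∧ p.2 ∣ n.2 ∧ a * n.1 / p.1 ^ 2 = b * n.2 / p.2 ^ 2 then afeWeight q n else 0)) =
      fun n ↦ afeWeight q n * (diagCount a b n : ℝ) := by
    funext n
    rw [diagCount_eq_sum ha hb, Finset.mul_sum]
    refine Finset.sum_congr rfl fun p _ ↦ ?_
    split_ifs <;> simp
  rw [hfun] at hlines
  -- the value: fibre count, then the kernel
  convert hlines using 1
  rw [sum_divisorPairs_gcd ha hb (fun c ↦ (c : ℝ) * ((a : ℝ) * b) ^ (-(1 / 2 : ℝ)) *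
    Corner.scriptW ((((a / c) * (b / c) : ℕ) : ℝ) / qhat q ^ 2))]
  rw [Corner.trueDiagKernel, Corner.hKernel]
  have hR : ∑ c ∈ (a.gcd b).divisors, ((((a / c) * (b / c)).divisors.card : ℕ) : ℝ) *
      ((c : ℝ) * ((a : ℝ) * b) ^ (-(1 / 2 : ℝ)) *
        Corner.scriptW ((((a / c) * (b / c) : ℕ) : ℝ) / qhat q ^ 2)) =
      ((a : ℝ) * b) ^ (-(1 / 2 : ℝ)) * ∑ c ∈ (a.gcd b).divisors,
        (c : ℝ) * ((((a / c) * (b / c)).divisors.card : ℕ) : ℝ) *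
          Corner.scriptW ((((a / c) * (b / c) : ℕ) : ℝ) / qhat q ^ 2) := by
    rw [Finset.mul_sum]
    exact Finset.sum_congr rfl fun c _ ↦ by ring
  have h2 : ((a : ℝ) * b) ^ (1 / 2 : ℝ) = ((a : ℝ) * b) ^ (-(1 / 2 : ℝ)) * ((a : ℝ) * b) := by
    have : ((a : ℝ) * b) ^ (-(1 / 2 : ℝ)) * ((a : ℝ) * b) =
        ((a : ℝ) * b) ^ (-(1 / 2 : ℝ)) * ((a : ℝ) * b) ^ (1 : ℝ) := by rw [Real.rpow_one]
    rw [this, ← Real.rpow_add hab]; norm_num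
  rw [hR, h2, mul_assoc, mul_div_cancel₀ _ hab.ne']

/-- The same identity in `ℂ`, in the shape used by `twistedSecond_eq_diag_sub_off`.
[cite: KowalskiMichelVanderKam2000, (21)–(23) p. 12 — derivation] -/
theorem tsum_afeWeight_diagCount (hq : 1 ≤ q) {a b : ℕ} (ha : a ≠ 0) (hb : b ≠ 0) :
    ∑' n : ℕ × ℕ, (afeWeight q n : ℂ) * (diagCount a b n : ℂ) =
      (((((a : ℝ) * b) ^ (1 / 2 : ℝ) * Corner.trueDiagKernel (qhat q) a b : ℝ)) : ℂ) := by
  rw [← (hasSum_afeWeight_diagCount hq ha hb).tsum_eq, Complex.ofReal_tsum]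
  refine tsum_congr fun n ↦ ?_
  push_cast
  ring

/-! ### The off-diagonal series and the split -/

/-- **The off-diagonal of the heart**, explicit: `OFF_q(l,m) := 2q̂ Σ_{(n₁,n₂)} w_q(n₁,n₂)
Σ_{d₁∣(l,n₁)} Σ_{d₂∣(m,n₂)} J_q(l n₁/d₁², m n₂/d₂²)` (absolutely convergent for `1 ≤ l, m < q`,
`twistedSecond_eq_diag_sub_off`), `J_q` the Kloosterman–Bessel series of Petersson's formula
(`KowalskiMichel2000.petJ`). A bookkeeping abbreviation of this line.
[cite: KowalskiMichelVanderKam2000, §3 Lemma 3.3 p. 9 (the off-diagonal terms) — derivation] -/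
def offDiag (q : ℕ) [NeZero q] (l m : ℕ) : ℂ :=
  2 * (qhat q : ℂ) * ∑' n : ℕ × ℕ, (afeWeight q n : ℂ) *
    ∑ d₁ ∈ (l.gcd n.1).divisors, ∑ d₂ ∈ (m.gcd n.2).divisors,
      KowalskiMichel2000.petJ q (l * n.1 / d₁ ^ 2) (m * n.2 / d₂ ^ 2)

/-- The `X²` mollifier coefficient factors as `x_m · m^{−1/2}`:
`mollifierCoeff X² M m = xsq M m · m^{−1/2}`. [cite: KowalskiMichelVanderKam2000, (9) p. 7] -/
theorem mollifierCoeff_X_sq (M : ℝ) (m : ℕ) :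
    mollifierCoeff (X ^ 2) M m = xsq M m * (m : ℝ) ^ (-(1 / 2 : ℝ)) := by
  simp only [mollifierCoeff, xsq, eval_pow, eval_X]
  ring

/-- **H4 — the exact Petersson/AFE split at `P = X²`, `Q = 1`.** For `q` prime and `1 ≤ M < q`:
`Q^h(X², 1; M) = 2q̂·Σ_{l,m ≤ M} x_l x_m·K_true(q̂; l,m) − Σ_{l,m ≤ M} (x_l l^{−1/2})(x_m m^{−1/2})·OFF_q(l,m)`.
[cite: KowalskiMichelVanderKam2000, (21)–(23) p. 12–13, §6 p. 19; KowalskiMichel2000, §2.4.2 p. 312 — derivation] -/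
theorem QhPQ_X_sq_one_split [NeZero q] (hq : q.Prime) {M : ℝ} (hM : 1 ≤ M) (hMq : M < q) :
    QhPQ q (X ^ 2) 1 M =
      ((2 * qhat q * ∑ l ∈ Icc 1 ⌊M⌋₊, ∑ m ∈ Icc 1 ⌊M⌋₊,
          xsq M l * xsq M m * Corner.trueDiagKernel (qhat q) l m : ℝ) : ℂ) -
        ∑ l ∈ Icc 1 ⌊M⌋₊, ∑ m ∈ Icc 1 ⌊M⌋₊,
          ((mollifierCoeff (X ^ 2) M l * mollifierCoeff (X ^ 2) M m : ℝ) : ℂ) * offDiag q l m := by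
  have hq1 : 1 ≤ q := hq.one_lt.le
  have hlt : ∀ l ∈ Icc 1 ⌊M⌋₊, 1 ≤ l ∧ l < q := by
    intro l hl
    rw [Finset.mem_Icc] at hl
    refine ⟨hl.1, ?_⟩
    have : (l : ℝ) ≤ M := (Nat.cast_le.2 hl.2).trans (Nat.floor_le (by linarith))
    exact_mod_cast this.trans_lt hMq
  rw [QhPQ_one_eq_sum_twistedSecond hq]
  push_cast
  rw [Finset.mul_sum, ← Finset.sum_sub_distrib]
  refine Finset.sum_congr rfl fun l hl ↦ ?_
  rw [Finset.mul_sum, ← Finset.sum_sub_distrib]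
  refine Finset.sum_congr rfl fun m hm ↦ ?_
  obtain ⟨hl1, hlq⟩ := hlt l hl
  obtain ⟨hm1, hmq⟩ := hlt m hm
  obtain ⟨-, -, hT⟩ := twistedSecond_eq_diag_sub_off hq hl1 hlq hm1 hmq
  rw [hT, tsum_afeWeight_diagCount hq1 (by omega) (by omega), offDiag, mollifierCoeff_X_sq,
    mollifierCoeff_X_sq]
  have hl0 : (0 : ℝ) < l := by exact_mod_cast hl1
  have hm0 : (0 : ℝ) < m := by exact_mod_cast hm1
  have hpow : (l : ℝ) ^ (-(1 / 2 : ℝ)) * (m : ℝ) ^ (-(1 / 2 : ℝ)) * ((l : ℝ) * m) ^ (1 / 2 : ℝ) = 1 := by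
    rw [Real.mul_rpow hl0.le hm0.le, Real.rpow_neg hl0.le, Real.rpow_neg hm0.le]
    have h1 : 0 < (l : ℝ) ^ (1 / 2 : ℝ) := by positivity
    have h2 : 0 < (m : ℝ) ^ (1 / 2 : ℝ) := by positivity
    field_simp
  have hpowC : (((l : ℝ) ^ (-(1 / 2 : ℝ)) : ℝ) : ℂ) * (((m : ℝ) ^ (-(1 / 2 : ℝ)) : ℝ) : ℂ) *
      ((((l : ℝ) * m) ^ (1 / 2 : ℝ) : ℝ) : ℂ) = 1 := by exact_mod_cast hpow
  push_cast
  linear_combination (2 * (qhat q : ℂ) * ((xsq M l : ℝ) : ℂ) * ((xsq M m : ℝ) : ℂ) *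
    ((Corner.trueDiagKernel (qhat q) l m : ℝ) : ℂ)) * hpowC

end Summit.Parity.GeneralizedHardyLittlewood.Theorems.BeyondDiagonalBeatsQuarter.PeterssonSplit
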